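import Mathlib

/-!
# A2HodgeType — invariance under the complex structure on wedges of (anti)linear forms

Kernel-checked form of the computation in Lemma A4.2.3 of route/T4-A2-p6.md (sub-claim A2 of
route/TIER4.md, cell pub-hodge-repro2).  For a complex vector space `V` write `J v := I • v`.
A complex-valued `ℝ`-bilinear alternating form `E` on `V` is pulled back by `J` to
`J^*E (v, w) := E (I • v) (I • w)`.  On the wedge `ω ∧ ω'` of two `ℝ`-linear forms
`V → ℂ`,

* `J^*(ω ∧ ω') = -(ω ∧ ω')` if both forms are `ℂ`-linear (`ω (I • v) = I * ω v`),
* `J^*(ω ∧ ω̄') = ω ∧ ω̄'` if one is `ℂ`-linear and the other `ℂ`-antilinear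
  (`ω̄' (I • v) = -I * ω̄' v`),
* `J^*(ω̄ ∧ ω̄') = -(ω̄ ∧ ω̄')` if both are antilinear.

So, with respect to the printed decomposition `Alt²_ℝ(V, ℂ) = ∧²Ω ⊕ (Ω ⊗ Ω̄) ⊕ ∧²Ω̄`
(Lange, Prop. 1.2.8 — a cited input, not formalised here), `J^*` is `−1` on the `(2,0)` and
`(0,2)` summands and `+1` on the `(1,1)` summand, and a form is `J^*`-invariant iff its
components in the two outer summands vanish (`Jstar_eq_self_iff`).  This is the clause that
Lange's proof of Prop. 1.2.9 leaves as "which means" (p0034 l. 24), and it is what makes the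
Lefschetz (1,1) theorem of Prop. A4.2.4 applicable to the rational classes of type (1,1).
-/

namespace Summit.Ventures.HodgeRepro2.A2HodgeType

open Complex

variable {V : Type*} [AddCommGroup V] [Module ℂ V]

/-- The wedge of two `ℝ`-linear complex-valued forms:
`(ω ∧ ω') (v, w) = ω v * ω' w - ω w * ω' v` (an alternating `ℝ`-bilinear form on `V`). -/
noncomputable def wedge (ω ω' : V →ₗ[ℝ] ℂ) : V → V → ℂ := fun v w => ω v * ω' w - ω w * ω' v

/-- Pull-back of a form by the complex structure `J = I • ·`: `J^*E (v, w) = E (I • v) (I • w)`. -/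
def Jstar (E : V → V → ℂ) : V → V → ℂ := fun v w => E (I • v) (I • w)

/-! The `(1,0)`-forms `Ω = Hom_ℂ(V, ℂ)` are the `ℝ`-linear forms with `ω (I • v) = I * ω v`;
the `(0,1)`-forms `Ω̄` (antilinear forms) are those with `ω (I • v) = -I * ω v`.  These two
eigen-properties are all that the sign computations use, so they are taken as hypotheses. -/

/-- The wedge is alternating: `(ω ∧ ω') (w, v) = -(ω ∧ ω') (v, w)`. -/
theorem wedge_antisymm (ω ω' : V →ₗ[ℝ] ℂ) (v w : V) : wedge ω ω' w v = -wedge ω ω' v w := by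
  simp only [wedge]; ring

/-- Every `ℂ`-linear form, restricted to `ℝ`, satisfies `ω (I • v) = I * ω v`. -/
theorem restrictScalars_smul_I (ω : V →ₗ[ℂ] ℂ) (v : V) :
    (ω.restrictScalars ℝ) (I • v) = I * (ω.restrictScalars ℝ) v := by
  simp

/-- Every `ℂ`-antilinear (conjugate-linear) form, viewed as an `ℝ`-linear map, satisfies
`ω (I • v) = -I * ω v`. -/
theorem smul_I_of_conj (ω : V →ₗ[ℝ] ℂ) (h : ∀ (c : ℂ) v, ω (c • v) = (starRingEnd ℂ) c * ω v)
    (v : V) : ω (I • v) = -I * ω v := by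
  rw [h I v]
  simp

/-- `(2,0)`-type: `J^*` acts by `-1` on the wedge of two `ℂ`-linear forms. -/
theorem Jstar_wedge_lin_lin {ω ω' : V →ₗ[ℝ] ℂ} (hω : ∀ v, ω (I • v) = I * ω v)
    (hω' : ∀ v, ω' (I • v) = I * ω' v) :
    Jstar (wedge ω ω') = fun v w => -wedge ω ω' v w := by
  funext v w
  simp only [Jstar, wedge, hω v, hω w, hω' v, hω' w]
  linear_combination (ω v * ω' w - ω w * ω' v) * I_sq

/-- `(1,1)`-type: `J^*` acts by `+1` on the wedge of a `ℂ`-linear and a `ℂ`-antilinear form. -/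
theorem Jstar_wedge_lin_antilin {ω ω' : V →ₗ[ℝ] ℂ} (hω : ∀ v, ω (I • v) = I * ω v)
    (hω' : ∀ v, ω' (I • v) = -I * ω' v) :
    Jstar (wedge ω ω') = wedge ω ω' := by
  funext v w
  simp only [Jstar, wedge, hω v, hω w, hω' v, hω' w]
  linear_combination (-(ω v * ω' w - ω w * ω' v)) * I_sq

/-- `(0,2)`-type: `J^*` acts by `-1` on the wedge of two `ℂ`-antilinear forms. -/
theorem Jstar_wedge_antilin_antilin {ω ω' : V →ₗ[ℝ] ℂ} (hω : ∀ v, ω (I • v) = -I * ω v)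
    (hω' : ∀ v, ω' (I • v) = -I * ω' v) :
    Jstar (wedge ω ω') = fun v w => -wedge ω ω' v w := by
  funext v w
  simp only [Jstar, wedge, hω v, hω w, hω' v, hω' w]
  linear_combination (ω v * ω' w - ω w * ω' v) * I_sq

/-- `J^*` is additive. -/
theorem Jstar_add (E E' : V → V → ℂ) : Jstar (E + E') = Jstar E + Jstar E' := by
  funext v w; simp [Jstar]

/-- `J^*` commutes with negation. -/
theorem Jstar_neg (E : V → V → ℂ) : Jstar (-E) = -Jstar E := by
  funext v w; simp [Jstar]

/-- **Eigen-decomposition form of Lemma A4.2.3.**  If `E = Ep + Em` with `J^*Ep = Ep`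
(the `(1,1)`-component) and `J^*Em = -Em` (the sum of the `(2,0)`- and `(0,2)`-components),
then `E` is `J^*`-invariant if and only if `Em = 0`. -/
theorem Jstar_eq_self_iff {E Ep Em : V → V → ℂ} (h : E = Ep + Em) (hp : Jstar Ep = Ep)
    (hm : Jstar Em = -Em) : Jstar E = E ↔ Em = 0 := by
  subst h
  rw [Jstar_add, hp, hm]
  constructor
  · intro hEq
    funext v w
    have h1 := congrFun (congrFun hEq v) w
    simp only [Pi.add_apply, Pi.neg_apply] at h1
    have h2 : (2 : ℂ) * Em v w = 0 := by linear_combination -h1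
    simpa using h2
  · intro hEm
    rw [hEm]
    simp

/-- The concrete instance: a form `E = Σ (2,0)-wedges + Σ (1,1)-wedges + Σ (0,2)-wedges`
is `J^*`-invariant iff the `(2,0)`- and `(0,2)`-parts cancel; in particular a form which is a
finite sum of wedges `ω ∧ ω̄'` with `ω` linear and `ω̄'` antilinear is `J^*`-invariant. -/
theorem Jstar_eq_self_of_sum_lin_antilin {ι : Type*} (s : Finset ι)
    (ω : ι → V →ₗ[ℝ] ℂ) (ω' : ι → V →ₗ[ℝ] ℂ) (hω : ∀ i v, (ω i) (I • v) = I * (ω i) v)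
    (hω' : ∀ i v, (ω' i) (I • v) = -I * (ω' i) v) :
    Jstar (∑ i ∈ s, wedge (ω i) (ω' i)) = ∑ i ∈ s, wedge (ω i) (ω' i) := by
  classical
  induction s using Finset.induction_on with
  | empty => funext v w; simp [Jstar]
  | insert i s hi ih =>
    rw [Finset.sum_insert hi, Jstar_add, ih, Jstar_wedge_lin_antilin (hω i) (hω' i)]

end Summit.Ventures.HodgeRepro2.A2HodgeType
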